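import Literature.NumberTheory.LFunctions.EquivalentsJensenProofs
import Literature.NumberTheory.LFunctions.XiMoments
import Mathlib.Algebra.CubicDiscriminant
import HarnessLib

/-!
# The higher order Turán inequalities for the Riemann `ξ`-function (Dimitrov–Lucas 2011) — proved

Trunk T-NT-LFUNC (`Literature/NumberTheory/LFunctions`). Dimitrov–Lucas, Proc. AMS 139 (2011)
1013–1022, prove that the Maclaurin coefficients `γ̂_k = k! b̂_k/(2k)!` of
`ξ₁(z) = Σ γ̂_k z^k/k!` (`(1/8) ξ(x/2) = Σ (-1)^k b̂_k x^{2k}/(2k)!`, `b̂_k = ∫₀^∞ t^{2k} Φ(t) dt`, p. 1014)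
satisfy the HIGHER ORDER TURÁN INEQUALITIES (5)
`H_k := 4(γ_k² − γ_{k−1}γ_{k+1})(γ_{k+1}² − γ_kγ_{k+2}) − (γ_kγ_{k+1} − γ_{k−1}γ_{k+2})² ≥ 0` (`k ∈ ℕ`)
[DimitrovLucas2011, abstract: "we prove that the higher order Turán inequalities also hold for the
ξ-function", and Cor. 1], which together with the Turán inequalities is equivalent to the
hyperbolicity of the third degree generalized Jensen polynomials
`g_{3,k−1}(x) = γ̂_{k−1} + 3γ̂_k x + 3γ̂_{k+1} x² + γ̂_{k+2} x³` [DimitrovLucas2011, Lemma 1, Cor. 1].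

ATTRIBUTION NOTE (2026-08-26). In the paper, (5) for `ξ` is derived as Thm. 1 + Thm. B, where
Thm. 1 asserts `H̃_k ≥ 0` for EVERY admissible kernel `K` with `(log K(√t))″ < 0` for `t > 0`
(their (8): STRICT log-concavity of `K(√t)`). Thm. 1 is FALSE as stated:
`Literature.Barriers.RiemannHypothesis.not_dimitrovLucas2011_theorem1`
(`Literature/Barriers/RiemannHypothesis/JensenPolynomialsLogConcaveKernel.lean`) exhibits the
admissible kernels `e^{−t²−εt⁴}(1 + t²/10 + 49t⁴/10⁴)`, which satisfy (8)
(`LogConcaveKernel.deriv2_log_K_sqrt_neg`: `(log K(√s))″ < 0` for `s > 0`), with `H̃_1 < 0` (the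
last Mean Value step on p. 1020 crosses the diagonal zero of `A(y,z) = (z²−y²)B`); for ONE explicit
admissible kernel, `K_β(t) = exp(−t² − t⁴/1000)(1 + t²/20 + 17t⁴/8000)` ((8) with margin
`(log K_β(√s))″ ≤ −1/4000`), the value is enclosed in the kernel:
`−1.13732·10⁻⁶·π² < H̃_1(K_β) < −1.13731·10⁻⁶·π²` in Thm. 1's full-line moments
(`Literature.Barriers.RiemannHypothesis.ExplicitKernel.dlHtilde_Kb_one_fullLine_mem`, same file).
The statement (5)/Cor. 1 for `ξ` itself is TRUE, and the tree's proof below does NOT use the paper's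
kernel argument: it is `jensenPoly_xiTaylorCoeff_splits_of_le` (hyperbolicity of `J^{d,n}_γ` for
all `n` and `d ≤ 64`, from the kernel-certified Riemann hypothesis up to height `16` via
Chasse/Kim–Lee/Obreschkoff) + `higherTuran_nonneg_of_splits` (Lemma 1, "only if", via
`Cubic.discr`). No theorem of the tree depends on Thm. 1.

In the tree the third degree Jensen polynomials of `γ = xiTaylorCoeff` (`= 64·4^k·γ̂_k`,
`xiTaylorCoeff_eq_xiMoment`; `jensenPoly γ 3 n = g_{3,n}` up to this rescaling) are already hyperbolic
for every shift (`jensenPoly_xiTaylorCoeff_splits_of_le`, `d ≤ 64`, from the kernel-certified Riemann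
hypothesis up to height `16`). This file extracts the printed INEQUALITY (5) from that hyperbolicity —
the "only if" half of Lemma 1 — via Mathlib's cubic discriminant: for `a x³ + 3b x² + 3c x + d`,
`Cubic.discr = 27·[4(b² − ac)(c² − bd) − (ad − bc)²]`, and a real-rooted cubic has
`discr = (a²(x−y)(x−z)(y−z))² ≥ 0` (`Cubic.discr_eq_prod_three_roots`). Every monomial of `H_k` has
total index `4k + 2`, so the inequality for `xiTaylorCoeff` is the printed one for `γ̂` up to the
positive factor `64⁴·4^{4k+2}` (replacing `a_j` by `Cλ^{m+j} a_j` multiplies `H` by `C⁴λ^{4m+6}`).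

## Contents (all proved; theorems only)
* `discr_eq_higherTuran` — for `a₀ + 3a₁X + 3a₂X² + a₃X³`, Mathlib's `Cubic.discr` is `27·H`;
* `higherTuran_nonneg_of_splits` — Lemma 1, "only if" half: a real-rooted cubic
  `a₀ + 3a₁X + 3a₂X² + a₃X³` (`a₃ ≠ 0`) has `H(a₀, a₁, a₂, a₃) ≥ 0`;
* `jensenPoly_three_eq_toPoly` — `J^{3,n}_γ` as a `Cubic`;
* `xiTaylorCoeff_higherTuran_nonneg` — (5) for `γ = xiTaylorCoeff`, every shift `n`.

## References
* D. K. Dimitrov, F. R. Lucas, *Higher order Turán inequalities for the Riemann ξ-function*,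
  Proc. Amer. Math. Soc. 139 (2011) 1013–1022: (4), (5), Lemma 1 (p. 1015), Thm. 1 and Cor. 1
  (p. 1017). [DimitrovLucas2011]
* M. Griffin, K. Ono, L. Rolen, D. Zagier, PNAS 116 (2019) 11103–11110, eq. (1)–(2). [GORZPNAS2019]
-/

noncomputable section

open Polynomial

namespace Literature.NumberTheory.LFunctions

/-- For the "binomial" cubic `a₀ + 3a₁X + 3a₂X² + a₃X³`, Mathlib's cubic discriminant equals `27·H`
with `H = 4(a₁² − a₀a₂)(a₂² − a₁a₃) − (a₁a₂ − a₀a₃)²` the higher order Turán expression of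
Dimitrov–Lucas (5) (there with `a₀ = γ_{k-1}, …, a₃ = γ_{k+2}`). [cite: DimitrovLucas2011, (5) and Lemma 1] -/
theorem discr_eq_higherTuran (a₀ a₁ a₂ a₃ : ℝ) :
    (⟨a₃, 3 * a₂, 3 * a₁, a₀⟩ : Cubic ℝ).discr =
      27 * (4 * (a₁ ^ 2 - a₀ * a₂) * (a₂ ^ 2 - a₁ * a₃) - (a₁ * a₂ - a₀ * a₃) ^ 2) := by
  simp only [Cubic.discr]
  ring

/-- **Dimitrov–Lucas, Lemma 1 ("only if" half).** If the real cubic `a₀ + 3a₁X + 3a₂X² + a₃X³`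
(`a₃ ≠ 0`) is hyperbolic, then the higher order Turán expression is nonnegative:
`4(a₁² − a₀a₂)(a₂² − a₁a₃) − (a₁a₂ − a₀a₃)² ≥ 0` (the discriminant of a real-rooted cubic is a
square). [cite: DimitrovLucas2011, Lemma 1] -/
theorem higherTuran_nonneg_of_splits {a₀ a₁ a₂ a₃ : ℝ} (h₃ : a₃ ≠ 0)
    (hs : (Cubic.toPoly ⟨a₃, 3 * a₂, 3 * a₁, a₀⟩).Splits) :
    0 ≤ 4 * (a₁ ^ 2 - a₀ * a₂) * (a₂ ^ 2 - a₁ * a₃) - (a₁ * a₂ - a₀ * a₃) ^ 2 := by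
  have ha : (⟨a₃, 3 * a₂, 3 * a₁, a₀⟩ : Cubic ℝ).a ≠ 0 := h₃
  have hs' : ((⟨a₃, 3 * a₂, 3 * a₁, a₀⟩ : Cubic ℝ).toPoly.map (RingHom.id ℝ)).Splits := by
    simpa only [Polynomial.map_id] using hs
  obtain ⟨x, y, z, hr⟩ := (Cubic.splits_iff_roots_eq_three ha).1 hs'
  have hD := Cubic.discr_eq_prod_three_roots ha hr
  simp only [RingHom.id_apply] at hD
  have h27 : 27 * (4 * (a₁ ^ 2 - a₀ * a₂) * (a₂ ^ 2 - a₁ * a₃) - (a₁ * a₂ - a₀ * a₃) ^ 2) =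
      (a₃ * a₃ * (x - y) * (x - z) * (y - z)) ^ 2 := by
    rw [← discr_eq_higherTuran]; exact hD
  nlinarith [sq_nonneg (a₃ * a₃ * (x - y) * (x - z) * (y - z))]

/-- The degree-three Jensen polynomial as a `Cubic`:
`J^{3,n}_γ = γ(n) + 3γ(n+1)X + 3γ(n+2)X² + γ(n+3)X³` (GORZ eq. (2), `d = 3`; Dimitrov–Lucas (4),
`g_{3,n}`). [cite: DimitrovLucas2011, (4)] -/
theorem jensenPoly_three_eq_toPoly (γ : ℕ → ℝ) (n : ℕ) :
    jensenPoly γ 3 n = Cubic.toPoly ⟨γ (n + 3), 3 * γ (n + 2), 3 * γ (n + 1), γ n⟩ := by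
  simp only [jensenPoly, Cubic.toPoly, Finset.sum_range_succ, Finset.sum_range_zero, zero_add,
    add_zero, pow_zero, mul_one, pow_one]
  norm_num [Nat.choose]
  ring

/-- **Dimitrov–Lucas 2011: the higher order Turán inequalities hold for the Riemann `ξ`-function**
(Proc. AMS 139, abstract and Cor. 1 — the statement (5) for `ξ`; in the paper derived as Thm. 1 +
Thm. B, but Thm. 1 is false as stated for general admissible kernels, see the module docstring and
`Literature.Barriers.RiemannHypothesis.not_dimitrovLucas2011_theorem1`), in the
Griffin–Ono–Rolen–Zagier units `γ = xiTaylorCoeff` (`= 64·4^k·γ̂_k`; every monomial has total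
index `4n + 6`, so the sign is normalisation-independent): for every `n`,
`4(γ(n+1)² − γ(n)γ(n+2))(γ(n+2)² − γ(n+1)γ(n+3)) − (γ(n+1)γ(n+2) − γ(n)γ(n+3))² ≥ 0`.
Proved here from the tree's hyperbolicity of `J^{3,n}_γ` for all `n`
(`jensenPoly_xiTaylorCoeff_splits_of_le`: `d ≤ 64`, all shifts, from RH verified to height `16`,
Chasse/Kim–Lee) and `higherTuran_nonneg_of_splits` (Lemma 1), NOT by the paper's kernel argument.
[cite: DimitrovLucas2011, Corollary 1 and (5)] -/
theorem xiTaylorCoeff_higherTuran_nonneg (n : ℕ) :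
    0 ≤ 4 * (xiTaylorCoeff (n + 1) ^ 2 - xiTaylorCoeff n * xiTaylorCoeff (n + 2)) *
        (xiTaylorCoeff (n + 2) ^ 2 - xiTaylorCoeff (n + 1) * xiTaylorCoeff (n + 3)) -
      (xiTaylorCoeff (n + 1) * xiTaylorCoeff (n + 2) - xiTaylorCoeff n * xiTaylorCoeff (n + 3)) ^ 2 := by
  have hs : (jensenPoly xiTaylorCoeff 3 n).Splits :=
    jensenPoly_xiTaylorCoeff_splits_of_le (by norm_num) n
  rw [jensenPoly_three_eq_toPoly] at hs
  exact higherTuran_nonneg_of_splits (xiTaylorCoeff_pos_holds (n + 3)).ne' hs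

end Literature.NumberTheory.LFunctions

end
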